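import Mathlib
import HarnessLib
import Summits.ValiantsHypothesis.ValiantsHypothesis.Theorems.MonotoneRestorationOrbitRestorationQPSuperAtoms
import Summits.ValiantsHypothesis.ValiantsHypothesis.Theorems.MonotoneRestorationOrbitRestorationQPRowSymmetricSuperAtoms
import Summits.ValiantsHypothesis.ValiantsHypothesis.Theorems.MonotoneRestorationOrbitRestorationQPEvenNewton

/-!
# Sign-stable families of row-atom polynomials have narrow products (the pairing theorem of the sign-twisted lane)

Route MonotoneRestoration, crux `OrbitRestorationQP` (stmt-ValiantsHypothesis-18293), SPAN-currency lane of the open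
sub-rung A_∞ (`stub_sigmaPiSigmaValue`), `ΠΣ` part; repair-census item R3 of `BLOCK-LANE-g7g5.md` (square roots of the
SIGN-TWISTED support blocks).  Helper (`--supports`), def-free.

THE MECHANISM.  Group the factors of a matrix-symmetric affine product by their COLUMN label `T`; the groupings `G_T` are
polynomials in the row atoms `x_{a, ψ_T b}`, `R_a` of the placed column core `ψ_T` (`ev_{ψ_T} P_T` in the notation of
`Theorems/…RowSymmetricSuperAtoms.lean`), the column renamings permute them exactly, and the row renamings act on ALL of
them by one sign character `ε` (`ε(σ)² = 1`).  This file proves that such a family has its product in the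
constant-treewidth span as soon as its cardinality is even (odd cardinality with `ε ≠ 1` is not row-invariant) — with NO
untwistedness hypothesis: the sign twists are killed by PAIRING (`G_T G_{T'}` and `G_T²` are row-invariant, hence
super-atom polynomials by the multisymmetric first fundamental theorem) and Newton's identities run inside the EVEN
subalgebra (`EvenNewton.esymm_mem_evenSubalgebra`).

* `evalRowAtoms_comp`, `exists_injective_evalRowAtoms`, `evalRowAtoms_mul_append` — plumbing for the evaluations
  `ev_ψ`: merging the core along a map, normalising any presentation to an INJECTIVELY placed core of no larger size,
  and the product of two presentations as one presentation on the appended core;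
* `sum_pow_mem_narrowSpan_of_stable_superAtomFactors` — power sums of an exactly permuted family of injectively
  placed super-atom polynomials are narrow (the averaging step of `SuperAtoms.prod_mem_narrowSpan_of_stable_superAtomFactors`);
* `prod_mem_of_even_psum_mem` — EVEN NEWTON GLUE in any subalgebra `A`: if `|ι|` is even, all `Σ_i φ_i^{2j} ∈ A` and all
  `(Σ_i φ_i^{2a+1})(Σ_i φ_i^{2b+1}) ∈ A`, then `Π_i φ_i ∈ A`;
* `sum_pair_pow_mem_narrowSpan_of_signStable` — for a sign-stable family and `u + v` even,
  `Σ_{i,i'} Lf_i^u Lf_{i'}^v ∈ span_ℂ {hom_{F,n} : tw F ≤ 2c₀ + 1}`;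
* **`prod_mem_narrowSpan_of_signStable_rowAtomFactors`** — THE PAIRING THEOREM: a finite family `Lf` of polynomials
  `Lf_i = ev_{ψ_i} P_i` on column cores of size `≤ c₀` (`2c₀ < n`), exactly permuted by the column renamings and
  multiplied by a common `ε(σ)` (`ε(σ)² = 1`) by the row renamings, of EVEN cardinality, has
  `Π_i Lf_i ∈ span_ℂ {hom_{F,n} : tw F ≤ 2c₀ + 1}`;
* `prod_mem_narrowSpan_of_rowInvariant_rowAtomFactors` — the untwisted companion (`ε = 1`, any cardinality,
  `tw ≤ c₀ + 1`).

Instances: the column Vandermondes `W_n = Π_q Vand(col q)` (`G_q = Vand(col q)`, `ε = sgn`, `n` even; landed earlier by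
hand in `…ColumnVandermondesNarrowSpan.lean`) and the generalised ones `Π_q Π_{a<a'} (α(x_{aq} − x_{a'q}) + β(R_a − R_{a'}))`
are covered uniformly.  Remaining for span-A₁: the bookkeeping that the column-label groupings of the sign-twisted blocks
of a matrix-symmetric affine product form such a family (from `LocalFormShape` / `BlockSigns`), and the doubly twisted
type `(1,1)` with both grouping parities odd.  No registered stub is closed; the crux and VP ≠ VNP are not moved.
[folklore; cite: DwivediPagoSeppelt2026, §8; Weyl1939, Chap. II §3; Macdonald1995, §I.2]
-/

noncomputable section

-- `Summit.ValiantsHypothesis.ValiantsHypothesis.…` is the tree's single-conjunct layout (Sub = Summit).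
set_option linter.dupNamespace false

namespace Summit.ValiantsHypothesis.ValiantsHypothesis.Theorems

namespace SuperAtoms

open MvPolynomial Finset Equiv
open Literature.Computability.AlgebraicComplexity (homPoly)
open Literature.Combinatorics.SimpleGraph (treewidth)

/-! ### Plumbing for the evaluations at the row atoms -/

/-- **Merging the core**: evaluating at the core `g ∘ π` is evaluating the `π`-merged source polynomial at `g`. [folklore] -/
theorem evalRowAtoms_comp (n c c' : ℕ) (π : Fin c → Fin c') (g : Fin c' → Fin n)
    (P : MvPolynomial (Fin n × (Fin c ⊕ Unit)) ℂ) :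
    aeval (fun w : Fin n × (Fin c ⊕ Unit) =>
        Sum.elim (fun b : Fin c => (X (w.1, (g ∘ π) b) : MvPolynomial (Fin n × Fin n) ℂ))
          (fun _ : Unit => ∑ j : Fin n, (X (w.1, j) : MvPolynomial (Fin n × Fin n) ℂ)) w.2) P =
    aeval (fun w : Fin n × (Fin c' ⊕ Unit) =>
        Sum.elim (fun b : Fin c' => (X (w.1, g b) : MvPolynomial (Fin n × Fin n) ℂ))
          (fun _ : Unit => ∑ j : Fin n, (X (w.1, j) : MvPolynomial (Fin n × Fin n) ℂ)) w.2)
      (rename (fun w : Fin n × (Fin c ⊕ Unit) => (w.1, Sum.map π id w.2)) P) := by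
  rw [aeval_rename]
  congr 1
  refine MvPolynomial.algHom_ext fun w => ?_
  rw [aeval_X, aeval_X]
  rcases w with ⟨a, b | u⟩
  · simp only [Function.comp_apply, Sum.map_inl, Sum.elim_inl]
  · simp only [Function.comp_apply, Sum.map_inr, id_eq, Sum.elim_inr]

/-- **Normalising a presentation to an injectively placed core of no larger size.** [folklore] -/
theorem exists_injective_evalRowAtoms (n c : ℕ) (ψ : Fin c → Fin n) (P : MvPolynomial (Fin n × (Fin c ⊕ Unit)) ℂ) :
    ∃ (c' : ℕ) (g : Fin c' → Fin n) (P' : MvPolynomial (Fin n × (Fin c' ⊕ Unit)) ℂ),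
      c' ≤ c ∧ Function.Injective g ∧
      aeval (fun w : Fin n × (Fin c ⊕ Unit) =>
        Sum.elim (fun b : Fin c => (X (w.1, ψ b) : MvPolynomial (Fin n × Fin n) ℂ))
          (fun _ : Unit => ∑ j : Fin n, (X (w.1, j) : MvPolynomial (Fin n × Fin n) ℂ)) w.2) P =
      aeval (fun w : Fin n × (Fin c' ⊕ Unit) =>
        Sum.elim (fun b : Fin c' => (X (w.1, g b) : MvPolynomial (Fin n × Fin n) ℂ))
          (fun _ : Unit => ∑ j : Fin n, (X (w.1, j) : MvPolynomial (Fin n × Fin n) ℂ)) w.2) P' := by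
  classical
  set s : Finset (Fin n) := (univ : Finset (Fin c)).image ψ with hs
  set e : {x // x ∈ s} ≃ Fin s.card := s.equivFin with he
  set g : Fin s.card → Fin n := fun i => ((e.symm i : {x // x ∈ s}) : Fin n) with hg
  set π : Fin c → Fin s.card := fun b => e ⟨ψ b, Finset.mem_image_of_mem ψ (Finset.mem_univ b)⟩ with hπ
  have hgπ : g ∘ π = ψ := by
    funext b
    simp only [hg, hπ, Function.comp_apply, Equiv.symm_apply_apply]
  refine ⟨s.card, g, rename (fun w : Fin n × (Fin c ⊕ Unit) => (w.1, Sum.map π id w.2)) P,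
    Finset.card_image_le.trans (by simp), ?_, ?_⟩
  · intro i j hij
    exact e.symm.injective (Subtype.ext hij)
  · rw [← evalRowAtoms_comp, hgπ]

/-- **The product of two presentations is a presentation on the appended core.** [folklore] -/
theorem evalRowAtoms_mul_append (n c c' : ℕ) (ψ : Fin c → Fin n) (ψ' : Fin c' → Fin n)
    (P : MvPolynomial (Fin n × (Fin c ⊕ Unit)) ℂ) (P' : MvPolynomial (Fin n × (Fin c' ⊕ Unit)) ℂ) :
    aeval (fun w : Fin n × (Fin c ⊕ Unit) =>
        Sum.elim (fun b : Fin c => (X (w.1, ψ b) : MvPolynomial (Fin n × Fin n) ℂ))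
          (fun _ : Unit => ∑ j : Fin n, (X (w.1, j) : MvPolynomial (Fin n × Fin n) ℂ)) w.2) P *
      aeval (fun w : Fin n × (Fin c' ⊕ Unit) =>
        Sum.elim (fun b : Fin c' => (X (w.1, ψ' b) : MvPolynomial (Fin n × Fin n) ℂ))
          (fun _ : Unit => ∑ j : Fin n, (X (w.1, j) : MvPolynomial (Fin n × Fin n) ℂ)) w.2) P' =
    aeval (fun w : Fin n × (Fin (c + c') ⊕ Unit) =>
        Sum.elim (fun b : Fin (c + c') => (X (w.1, Fin.append ψ ψ' b) : MvPolynomial (Fin n × Fin n) ℂ))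
          (fun _ : Unit => ∑ j : Fin n, (X (w.1, j) : MvPolynomial (Fin n × Fin n) ℂ)) w.2)
      (rename (fun w : Fin n × (Fin c ⊕ Unit) => (w.1, Sum.map (Fin.castAdd c') id w.2)) P *
        rename (fun w : Fin n × (Fin c' ⊕ Unit) => (w.1, Sum.map (Fin.natAdd c) id w.2)) P') := by
  have h1 : Fin.append ψ ψ' ∘ Fin.castAdd c' = ψ := funext fun i => Fin.append_left ψ ψ' i
  have h2 : Fin.append ψ ψ' ∘ Fin.natAdd c = ψ' := funext fun i => Fin.append_right ψ ψ' i
  rw [map_mul, ← evalRowAtoms_comp, ← evalRowAtoms_comp, h1, h2]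

/-! ### Power sums of exactly permuted super-atom families -/

/-- **Power sums of an exactly permuted family of injectively placed super-atom polynomials are narrow.**
[folklore; cite: DwivediPagoSeppelt2026, §8] -/
theorem sum_pow_mem_narrowSpan_of_stable_superAtomFactors (n w m : ℕ) {ι : Type} [Fintype ι]
    (Lf : ι → MvPolynomial (Fin n × Fin n) ℂ)
    (hstab : ∀ σ τ : Perm (Fin n), ∃ κ : Perm ι, ∀ i,
      rename (fun P : Fin n × Fin n => (σ P.1, τ P.2)) (Lf i) = Lf (κ i))
    (hloc : ∀ i, ∃ (c : ℕ) (eC : Fin c → Fin n) (Q : MvPolynomial ((Fin c ⊕ Unit) → ℕ) ℂ),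
      c + 1 ≤ w ∧ Function.Injective eC ∧
      Lf i = aeval (fun γ : (Fin c ⊕ Unit) → ℕ => ∑ a : Fin n, ∏ k : Fin c ⊕ Unit,
        (Sum.elim (fun b : Fin c => (X (a, eC b) : MvPolynomial (Fin n × Fin n) ℂ))
          (fun _ : Unit => ∑ j : Fin n, (X (a, j) : MvPolynomial (Fin n × Fin n) ℂ)) k) ^ γ k) Q) :
    (∑ i, Lf i ^ m) ∈ Submodule.span ℂ {p : MvPolynomial (Fin n × Fin n) ℂ |
        ∃ (a b : ℕ) (E : Multiset (Fin a × Fin b)),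
          treewidth (SimpleGraph.fromRel fun u v : Fin a ⊕ Fin b =>
            ∃ e ∈ E, u = Sum.inl e.1 ∧ v = Sum.inr e.2) ≤ w ∧ p = homPoly E n ℂ} := by
  classical
  have hG : ∀ σ τ : Perm (Fin n), (∑ i, (rename (fun P : Fin n × Fin n => (σ P.1, τ P.2)) (Lf i)) ^ m) =
      ∑ i, Lf i ^ m := by
    intro σ τ
    obtain ⟨κ, hκ⟩ := hstab σ τ
    simp_rw [hκ]
    exact Equiv.sum_comp κ (fun i => Lf i ^ m)
  have hsum : (∑ i, ∑ σ : Perm (Fin n), ∑ τ : Perm (Fin n),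
        (rename (fun P : Fin n × Fin n => (σ P.1, τ P.2)) (Lf i)) ^ m) =
      (Fintype.card (Perm (Fin n)) * Fintype.card (Perm (Fin n))) • ∑ i, Lf i ^ m := by
    rw [Finset.sum_comm]
    have h2 : ∀ σ : Perm (Fin n), (∑ i, ∑ τ : Perm (Fin n),
        (rename (fun P : Fin n × Fin n => (σ P.1, τ P.2)) (Lf i)) ^ m) =
        Fintype.card (Perm (Fin n)) • ∑ i, Lf i ^ m := by
      intro σ
      rw [Finset.sum_comm]
      simp_rw [hG]
      rw [Finset.sum_const, Finset.card_univ]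
    simp_rw [h2]
    rw [Finset.sum_const, Finset.card_univ, smul_smul]
  have hmem : (∑ i, ∑ σ : Perm (Fin n), ∑ τ : Perm (Fin n),
        (rename (fun P : Fin n × Fin n => (σ P.1, τ P.2)) (Lf i)) ^ m) ∈
      Submodule.span ℂ {p : MvPolynomial (Fin n × Fin n) ℂ |
        ∃ (a b : ℕ) (E : Multiset (Fin a × Fin b)),
          treewidth (SimpleGraph.fromRel fun u v : Fin a ⊕ Fin b =>
            ∃ e ∈ E, u = Sum.inl e.1 ∧ v = Sum.inr e.2) ≤ w ∧ p = homPoly E n ℂ} := by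
    refine Submodule.sum_mem _ fun i _ => ?_
    obtain ⟨c, eC, Q, hw, heC, hLi⟩ := hloc i
    obtain ⟨N₂, -, hN₂⟩ := CorePatterns.exists_sum_perm_comp_eq eC heC
    rw [hLi]
    simp only [rename_rowCol_aeval_superAtoms, ← map_pow]
    have h2 : (∑ τ : Perm (Fin n),
        aeval (fun γ : (Fin c ⊕ Unit) → ℕ => ∑ a : Fin n, ∏ k : Fin c ⊕ Unit,
          (Sum.elim (fun b : Fin c => (X (a, (⇑τ ∘ eC) b) : MvPolynomial (Fin n × Fin n) ℂ))
            (fun _ : Unit => ∑ j : Fin n, (X (a, j) : MvPolynomial (Fin n × Fin n) ℂ)) k) ^ γ k) (Q ^ m)) =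
        N₂ • ∑ ψ ∈ (univ : Finset (Fin c → Fin n)).filter (fun ψ => Function.Injective ψ),
          aeval (fun γ : (Fin c ⊕ Unit) → ℕ => ∑ a : Fin n, ∏ k : Fin c ⊕ Unit,
            (Sum.elim (fun b : Fin c => (X (a, ψ b) : MvPolynomial (Fin n × Fin n) ℂ))
              (fun _ : Unit => ∑ j : Fin n, (X (a, j) : MvPolynomial (Fin n × Fin n) ℂ)) k) ^ γ k) (Q ^ m) :=
      hN₂ (fun ψ => aeval (fun γ : (Fin c ⊕ Unit) → ℕ => ∑ a : Fin n, ∏ k : Fin c ⊕ Unit,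
        (Sum.elim (fun b : Fin c => (X (a, ψ b) : MvPolynomial (Fin n × Fin n) ℂ))
          (fun _ : Unit => ∑ j : Fin n, (X (a, j) : MvPolynomial (Fin n × Fin n) ℂ)) k) ^ γ k) (Q ^ m))
    rw [h2, Finset.sum_const, Finset.card_univ]
    refine nsmul_mem (nsmul_mem ?_ _) _
    refine (Submodule.span_mono ?_) (sum_injective_aeval_superAtoms_mem_narrowSpan n c (Q ^ m))
    rintro p ⟨a, b, E, hE, rfl⟩
    exact ⟨a, b, E, hE.trans hw, rfl⟩
  have hcard : ((Fintype.card (Perm (Fin n)) * Fintype.card (Perm (Fin n)) : ℕ) : ℂ) ≠ 0 := by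
    have : 0 < Fintype.card (Perm (Fin n)) := Fintype.card_pos
    exact_mod_cast (Nat.mul_pos this this).ne'
  have : (∑ i, Lf i ^ m) = ((Fintype.card (Perm (Fin n)) * Fintype.card (Perm (Fin n)) : ℕ) : ℂ)⁻¹ •
      ((Fintype.card (Perm (Fin n)) * Fintype.card (Perm (Fin n))) • ∑ i, Lf i ^ m) := by
    rw [← Nat.cast_smul_eq_nsmul ℂ, inv_smul_smul₀ hcard]
  rw [this, ← hsum]
  exact Submodule.smul_mem _ _ hmem

/-! ### Even Newton glue -/

/-- **EVEN NEWTON GLUE.**  In any `ℂ`-subalgebra `A`: if `|ι|` is even, all even power sums `Σ_i φ_i^{2j}` lie in `A`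
and all products of two odd power sums `(Σ_i φ_i^{2a+1})(Σ_i φ_i^{2b+1})` lie in `A`, then `Π_i φ_i ∈ A`.
[folklore; cite: Macdonald1995, §I.2] -/
theorem prod_mem_of_even_psum_mem {R : Type*} [CommRing R] [Algebra ℂ R] {ι : Type} [Fintype ι]
    (A : Subalgebra ℂ R) (φ : ι → R) (hι : Even (Fintype.card ι))
    (h2 : ∀ j : ℕ, (∑ i, φ i ^ (2 * j)) ∈ A)
    (hodd : ∀ a b : ℕ, (∑ i, φ i ^ (2 * a + 1)) * (∑ i, φ i ^ (2 * b + 1)) ∈ A) : (∏ i, φ i) ∈ A := by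
  classical
  obtain ⟨m, hm⟩ := hι
  have key := EvenNewton.esymm_mem_evenSubalgebra (σ := ι) (K := ℂ) m
  have hmap : aeval φ (MvPolynomial.esymm ι ℂ (2 * m)) ∈
      Algebra.adjoin ℂ (aeval φ '' ((Set.range fun j : ℕ => MvPolynomial.psum ι ℂ (2 * j)) ∪
        Set.range fun ab : ℕ × ℕ => MvPolynomial.psum ι ℂ (2 * ab.1 + 1) * MvPolynomial.psum ι ℂ (2 * ab.2 + 1))) := by
    rw [Algebra.adjoin_image]
    exact Subalgebra.mem_map.2 ⟨_, key, rfl⟩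
  have hpsum : ∀ k : ℕ, aeval φ (MvPolynomial.psum ι ℂ k) = ∑ i, φ i ^ k := by
    intro k
    simp only [MvPolynomial.psum, map_sum, map_pow, aeval_X]
  have heval : aeval φ (MvPolynomial.esymm ι ℂ (2 * m)) = ∏ i, φ i := by
    have h2m : 2 * m = Fintype.card ι := by rw [hm]; ring
    simp only [MvPolynomial.esymm, map_sum, map_prod, aeval_X]
    rw [h2m, ← Finset.card_univ, Finset.powersetCard_self, Finset.sum_singleton]
  rw [← heval]
  refine Algebra.adjoin_le ?_ hmap
  rintro _ ⟨q, hq, rfl⟩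
  rcases hq with ⟨j, rfl⟩ | ⟨ab, rfl⟩
  · rw [SetLike.mem_coe, hpsum]
    exact h2 j
  · rw [SetLike.mem_coe, map_mul, hpsum, hpsum]
    exact hodd ab.1 ab.2

/-! ### The pairing theorem -/

/-- **Pair sums of a sign-stable family are narrow.**  For a family `Lf_i = ev_{ψ_i} P_i` (column cores of size
`≤ c₀`, `2c₀ < n`) exactly permuted by the column renamings and multiplied by a common `ε(σ)` (`ε(σ)² = 1`) by the
row renamings, and exponents `u + v` even, `Σ_{(i,i')} Lf_i^u · Lf_{i'}^v ∈ span_ℂ {hom_{F,n} : tw F ≤ 2c₀ + 1}`.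
[folklore; cite: DwivediPagoSeppelt2026, §8; Weyl1939, Chap. II §3] -/
theorem sum_pair_pow_mem_narrowSpan_of_signStable (n c₀ : ℕ) (hc₀ : 2 * c₀ < n) {ι : Type} [Fintype ι]
    (Lf : ι → MvPolynomial (Fin n × Fin n) ℂ) (ε : Perm (Fin n) → ℂ) (hε : ∀ σ, ε σ * ε σ = 1)
    (hrow : ∀ (σ : Perm (Fin n)) (i : ι), rename (fun P : Fin n × Fin n => (σ P.1, P.2)) (Lf i) = C (ε σ) * Lf i)
    (hcol : ∀ τ : Perm (Fin n), ∃ κ : Perm ι, ∀ i, rename (fun P : Fin n × Fin n => (P.1, τ P.2)) (Lf i) = Lf (κ i))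
    (hloc : ∀ i, ∃ (c : ℕ) (ψ : Fin c → Fin n) (P : MvPolynomial (Fin n × (Fin c ⊕ Unit)) ℂ), c ≤ c₀ ∧
      Lf i = aeval (fun w : Fin n × (Fin c ⊕ Unit) =>
        Sum.elim (fun b : Fin c => (X (w.1, ψ b) : MvPolynomial (Fin n × Fin n) ℂ))
          (fun _ : Unit => ∑ j : Fin n, (X (w.1, j) : MvPolynomial (Fin n × Fin n) ℂ)) w.2) P)
    (u v : ℕ) (huv : Even (u + v)) :
    (∑ p : ι × ι, Lf p.1 ^ u * Lf p.2 ^ v) ∈ Submodule.span ℂ {p : MvPolynomial (Fin n × Fin n) ℂ |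
        ∃ (a b : ℕ) (E : Multiset (Fin a × Fin b)),
          treewidth (SimpleGraph.fromRel fun u v : Fin a ⊕ Fin b =>
            ∃ e ∈ E, u = Sum.inl e.1 ∧ v = Sum.inr e.2) ≤ 2 * c₀ + 1 ∧ p = homPoly E n ℂ} := by
  classical
  -- the sign disappears on pairs
  have hεuv : ∀ σ, ε σ ^ u * ε σ ^ v = 1 := by
    intro σ
    obtain ⟨t, ht⟩ := huv
    rw [← pow_add, ht, ← two_mul, pow_mul, sq, hε σ, one_pow]
  have hrow2 : ∀ (σ : Perm (Fin n)) (p : ι × ι),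
      rename (fun P : Fin n × Fin n => (σ P.1, P.2)) (Lf p.1 ^ u * Lf p.2 ^ v) = Lf p.1 ^ u * Lf p.2 ^ v := by
    intro σ p
    rw [map_mul, map_pow, map_pow, hrow, hrow, mul_pow, mul_pow, ← map_pow, ← map_pow]
    calc C (ε σ ^ u) * Lf p.1 ^ u * (C (ε σ ^ v) * Lf p.2 ^ v)
        = C (ε σ ^ u * ε σ ^ v) * (Lf p.1 ^ u * Lf p.2 ^ v) := by rw [map_mul]; ring
      _ = Lf p.1 ^ u * Lf p.2 ^ v := by rw [hεuv σ, map_one, one_mul]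
  have hsplit : ∀ (σ τ : Perm (Fin n)) (q : MvPolynomial (Fin n × Fin n) ℂ),
      rename (fun P : Fin n × Fin n => (σ P.1, τ P.2)) q =
        rename (fun P : Fin n × Fin n => (σ P.1, P.2)) (rename (fun P : Fin n × Fin n => (P.1, τ P.2)) q) := by
    intro σ τ q
    rw [rename_rename]
    rfl
  -- the pair family is exactly permuted
  have hstab : ∀ σ τ : Perm (Fin n), ∃ κ : Perm (ι × ι), ∀ p : ι × ι,
      rename (fun P : Fin n × Fin n => (σ P.1, τ P.2)) (Lf p.1 ^ u * Lf p.2 ^ v) =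
        Lf (κ p).1 ^ u * Lf (κ p).2 ^ v := by
    intro σ τ
    obtain ⟨κ, hκ⟩ := hcol τ
    refine ⟨Equiv.prodCongr κ κ, fun p => ?_⟩
    have hτ : rename (fun P : Fin n × Fin n => (P.1, τ P.2)) (Lf p.1 ^ u * Lf p.2 ^ v) =
        Lf (κ p.1) ^ u * Lf (κ p.2) ^ v := by
      rw [map_mul, map_pow, map_pow, hκ, hκ]
    rw [hsplit, hτ]
    exact hrow2 σ (κ p.1, κ p.2)
  -- each pair product is an injectively placed super-atom polynomial on a core of size ≤ 2 c₀
  have hloc2 : ∀ p : ι × ι, ∃ (c : ℕ) (eC : Fin c → Fin n) (Q : MvPolynomial ((Fin c ⊕ Unit) → ℕ) ℂ),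
      c + 1 ≤ 2 * c₀ + 1 ∧ Function.Injective eC ∧
      Lf p.1 ^ u * Lf p.2 ^ v = aeval (fun γ : (Fin c ⊕ Unit) → ℕ => ∑ a : Fin n, ∏ k : Fin c ⊕ Unit,
        (Sum.elim (fun b : Fin c => (X (a, eC b) : MvPolynomial (Fin n × Fin n) ℂ))
          (fun _ : Unit => ∑ j : Fin n, (X (a, j) : MvPolynomial (Fin n × Fin n) ℂ)) k) ^ γ k) Q := by
    intro p
    obtain ⟨c₁, ψ₁, P₁, hc₁, h₁⟩ := hloc p.1
    obtain ⟨c₂, ψ₂, P₂, hc₂, h₂⟩ := hloc p.2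
    -- one presentation of the pair product, then an injective one
    have hprod : Lf p.1 ^ u * Lf p.2 ^ v =
        aeval (fun w : Fin n × (Fin (c₁ + c₂) ⊕ Unit) =>
          Sum.elim (fun b : Fin (c₁ + c₂) => (X (w.1, Fin.append ψ₁ ψ₂ b) : MvPolynomial (Fin n × Fin n) ℂ))
            (fun _ : Unit => ∑ j : Fin n, (X (w.1, j) : MvPolynomial (Fin n × Fin n) ℂ)) w.2)
          (rename (fun w : Fin n × (Fin c₁ ⊕ Unit) => (w.1, Sum.map (Fin.castAdd c₂) id w.2)) (P₁ ^ u) *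
            rename (fun w : Fin n × (Fin c₂ ⊕ Unit) => (w.1, Sum.map (Fin.natAdd c₁) id w.2)) (P₂ ^ v)) := by
      rw [h₁, h₂, ← map_pow, ← map_pow, evalRowAtoms_mul_append]
    obtain ⟨c, g, P', hc, hg, hP'⟩ := exists_injective_evalRowAtoms n (c₁ + c₂) (Fin.append ψ₁ ψ₂)
      (rename (fun w : Fin n × (Fin c₁ ⊕ Unit) => (w.1, Sum.map (Fin.castAdd c₂) id w.2)) (P₁ ^ u) *
        rename (fun w : Fin n × (Fin c₂ ⊕ Unit) => (w.1, Sum.map (Fin.natAdd c₁) id w.2)) (P₂ ^ v))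
    rw [hP'] at hprod
    have hcn : c < n := by omega
    obtain ⟨Q, hQ⟩ := exists_aeval_superAtoms_of_rowSymmetric n c g hg hcn P' (fun σ => by
      rw [← hprod]; exact hrow2 σ p)
    exact ⟨c, g, Q, by omega, hg, by rw [hprod, hQ]⟩
  have h := sum_pow_mem_narrowSpan_of_stable_superAtomFactors n (2 * c₀ + 1) 1
    (fun p : ι × ι => Lf p.1 ^ u * Lf p.2 ^ v) hstab hloc2
  simpa only [pow_one] using h

/-- **THE PAIRING THEOREM: sign-stable families of row-atom polynomials of even cardinality have narrow products.**
Let `Lf_i = ev_{ψ_i} P_i` (`i ∈ ι`, `|ι|` even) be polynomials in the row atoms of column cores of size `≤ c₀`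
(`2c₀ < n`), exactly permuted by every column renaming and multiplied by a common scalar `ε(σ)` with `ε(σ)² = 1` by every
row renaming `σ`.  Then `Π_i Lf_i ∈ span_ℂ {hom_{F,n} : tw F ≤ 2c₀ + 1}`.
[folklore; cite: DwivediPagoSeppelt2026, §8; Weyl1939, Chap. II §3; Macdonald1995, §I.2] -/
theorem prod_mem_narrowSpan_of_signStable_rowAtomFactors (n c₀ : ℕ) (hc₀ : 2 * c₀ < n) {ι : Type} [Fintype ι]
    (hι : Even (Fintype.card ι))
    (Lf : ι → MvPolynomial (Fin n × Fin n) ℂ) (ε : Perm (Fin n) → ℂ) (hε : ∀ σ, ε σ * ε σ = 1)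
    (hrow : ∀ (σ : Perm (Fin n)) (i : ι), rename (fun P : Fin n × Fin n => (σ P.1, P.2)) (Lf i) = C (ε σ) * Lf i)
    (hcol : ∀ τ : Perm (Fin n), ∃ κ : Perm ι, ∀ i, rename (fun P : Fin n × Fin n => (P.1, τ P.2)) (Lf i) = Lf (κ i))
    (hloc : ∀ i, ∃ (c : ℕ) (ψ : Fin c → Fin n) (P : MvPolynomial (Fin n × (Fin c ⊕ Unit)) ℂ), c ≤ c₀ ∧
      Lf i = aeval (fun w : Fin n × (Fin c ⊕ Unit) =>
        Sum.elim (fun b : Fin c => (X (w.1, ψ b) : MvPolynomial (Fin n × Fin n) ℂ))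
          (fun _ : Unit => ∑ j : Fin n, (X (w.1, j) : MvPolynomial (Fin n × Fin n) ℂ)) w.2) P) :
    (∏ i, Lf i) ∈ Submodule.span ℂ {p : MvPolynomial (Fin n × Fin n) ℂ |
        ∃ (a b : ℕ) (E : Multiset (Fin a × Fin b)),
          treewidth (SimpleGraph.fromRel fun u v : Fin a ⊕ Fin b =>
            ∃ e ∈ E, u = Sum.inl e.1 ∧ v = Sum.inr e.2) ≤ 2 * c₀ + 1 ∧ p = homPoly E n ℂ} := by
  classical
  set V := Submodule.span ℂ {p : MvPolynomial (Fin n × Fin n) ℂ |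
        ∃ (a b : ℕ) (E : Multiset (Fin a × Fin b)),
          treewidth (SimpleGraph.fromRel fun u v : Fin a ⊕ Fin b =>
            ∃ e ∈ E, u = Sum.inl e.1 ∧ v = Sum.inr e.2) ≤ 2 * c₀ + 1 ∧ p = homPoly E n ℂ} with hV
  have h1 : (1 : MvPolynomial (Fin n × Fin n) ℂ) ∈ V :=
    Submodule.subset_span ⟨0, 0, 0, by rw [NarrowSpanAlgebra.treewidth_patternGraph_empty]; exact Nat.zero_le _,
      (NarrowSpanAlgebra.homPoly_empty_eq_one n).symm⟩
  set A : Subalgebra ℂ (MvPolynomial (Fin n × Fin n) ℂ) :=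
    V.toSubalgebra h1 (fun x y hx hy => NarrowSpanAlgebra.narrowSpan_mul_mem n (2 * c₀ + 1) hx hy) with hA
  have hpair := sum_pair_pow_mem_narrowSpan_of_signStable n c₀ hc₀ Lf ε hε hrow hcol hloc
  -- even power sums
  have heven : ∀ j : ℕ, (∑ i, Lf i ^ (2 * j)) ∈ V := by
    intro j
    have h := hpair (2 * j) 0 (by simp)
    simp only [pow_zero, mul_one] at h
    rw [Fintype.sum_prod_type] at h
    simp only [Finset.sum_const, Finset.card_univ] at h
    -- h : ∑ i, |ι| • Lf i ^ (2j) ∈ V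
    rcases Nat.eq_zero_or_pos (Fintype.card ι) with h0 | hpos
    · have : IsEmpty ι := Fintype.card_eq_zero_iff.1 h0
      simp
    · rw [← Finset.smul_sum] at h
      have hc : ((Fintype.card ι : ℕ) : ℂ) ≠ 0 := by exact_mod_cast hpos.ne'
      have : (∑ i, Lf i ^ (2 * j)) = ((Fintype.card ι : ℕ) : ℂ)⁻¹ • ((Fintype.card ι) • ∑ i, Lf i ^ (2 * j)) := by
        rw [← Nat.cast_smul_eq_nsmul ℂ, inv_smul_smul₀ hc]
      rw [this]
      exact Submodule.smul_mem _ _ h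
  -- products of two odd power sums
  have hodd : ∀ a b : ℕ, (∑ i, Lf i ^ (2 * a + 1)) * (∑ i, Lf i ^ (2 * b + 1)) ∈ V := by
    intro a b
    have h := hpair (2 * a + 1) (2 * b + 1) ⟨a + b + 1, by ring⟩
    rwa [Finset.sum_mul_sum, ← Fintype.sum_prod_type']
  exact Submodule.mem_toSubalgebra.1 (prod_mem_of_even_psum_mem A Lf hι
    (fun j => Submodule.mem_toSubalgebra.2 (heven j)) (fun a b => Submodule.mem_toSubalgebra.2 (hodd a b)))

/-- **The untwisted companion**: a family of ROW-INVARIANT row-atom polynomials (column cores of size `≤ c₀ < n`)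
exactly permuted by the column renamings has `Π_i Lf_i ∈ span_ℂ {hom_{F,n} : tw F ≤ c₀ + 1}` (any cardinality).
[folklore; cite: DwivediPagoSeppelt2026, §8; Weyl1939, Chap. II §3] -/
theorem prod_mem_narrowSpan_of_rowInvariant_rowAtomFactors (n c₀ : ℕ) (hc₀ : c₀ < n) {ι : Type} [Fintype ι]
    (Lf : ι → MvPolynomial (Fin n × Fin n) ℂ)
    (hrow : ∀ (σ : Perm (Fin n)) (i : ι), rename (fun P : Fin n × Fin n => (σ P.1, P.2)) (Lf i) = Lf i)
    (hcol : ∀ τ : Perm (Fin n), ∃ κ : Perm ι, ∀ i, rename (fun P : Fin n × Fin n => (P.1, τ P.2)) (Lf i) = Lf (κ i))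
    (hloc : ∀ i, ∃ (c : ℕ) (ψ : Fin c → Fin n) (P : MvPolynomial (Fin n × (Fin c ⊕ Unit)) ℂ), c ≤ c₀ ∧
      Lf i = aeval (fun w : Fin n × (Fin c ⊕ Unit) =>
        Sum.elim (fun b : Fin c => (X (w.1, ψ b) : MvPolynomial (Fin n × Fin n) ℂ))
          (fun _ : Unit => ∑ j : Fin n, (X (w.1, j) : MvPolynomial (Fin n × Fin n) ℂ)) w.2) P) :
    (∏ i, Lf i) ∈ Submodule.span ℂ {p : MvPolynomial (Fin n × Fin n) ℂ |
        ∃ (a b : ℕ) (E : Multiset (Fin a × Fin b)),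
          treewidth (SimpleGraph.fromRel fun u v : Fin a ⊕ Fin b =>
            ∃ e ∈ E, u = Sum.inl e.1 ∧ v = Sum.inr e.2) ≤ c₀ + 1 ∧ p = homPoly E n ℂ} := by
  classical
  have hsplit : ∀ (σ τ : Perm (Fin n)) (q : MvPolynomial (Fin n × Fin n) ℂ),
      rename (fun P : Fin n × Fin n => (σ P.1, τ P.2)) q =
        rename (fun P : Fin n × Fin n => (σ P.1, P.2)) (rename (fun P : Fin n × Fin n => (P.1, τ P.2)) q) := by
    intro σ τ q
    rw [rename_rename]
    rfl
  refine prod_mem_narrowSpan_of_stable_superAtomFactors n (c₀ + 1) Lf (fun σ τ => ?_) (fun i => ?_)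
  · obtain ⟨κ, hκ⟩ := hcol τ
    exact ⟨κ, fun i => by rw [hsplit, hκ, hrow]⟩
  · obtain ⟨c, ψ, P, hc, hLi⟩ := hloc i
    obtain ⟨c', g, P', hc', hg, hP'⟩ := exists_injective_evalRowAtoms n c ψ P
    have hcn : c' < n := by omega
    obtain ⟨Q, hQ⟩ := exists_aeval_superAtoms_of_rowSymmetric n c' g hg hcn P' (fun σ => by
      rw [← hP', ← hLi]; exact hrow σ i)
    exact ⟨c', g, Q, by omega, hg, by rw [hLi, hP', hQ]⟩

end SuperAtoms

end Summit.ValiantsHypothesis.ValiantsHypothesis.Theorems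

end
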